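import Summits.CriticalPhenomena.PercolationContinuityZ3.Theorems.SahiMasterFamily

/-!
# Two classical zero families lie in the zero-flag class `Z_k`, for every `k`

Companion of `SahiMasterFamily.lean` (crux `NoHeavyLowerTail`, stmt-CriticalPhenomena-4575; unit `prim-master-conj`).
The master equality conjecture `MasterFamilyEqIff k` predicts the zero locus of `E_k` on product measures to be the
recursive support class `SuppZeroFlag k` (`Z_k`).  Here we check, for EVERY `k` and purely combinatorially, that
`Z_k` contains the two largest proved zero families of the cell's censuses (prim-sahi CENSUS.md §1–2, IDENTITIES.md):

* `suppZeroFlag_of_pairwise_disjoint` — **mutually independent families** ("class A", independent splitting):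
  `k ≥ 2` events determined by pairwise disjoint coordinate sets form a zero flag (hence `E_k = 0`,
  `sahiE_ind_eq_zero_of_pairwise_disjoint`; the abstract form is `Literature.Combinatorics.Sahi2008.sahiE_eq_zero_of_indepMoments`);
* `suppZeroFlag_absorbingPair` — **absorbing pairs** (L1, "class B" at `k = 3`; ≈ 80 % of every exhaustive zero list):
  `(X, Y, G_1, …, G_m)` with `X, Y` determined by disjoint coordinate sets and `X ⊆ G_j`, `Y ⊆ G_j` for all `j` is a
  zero flag (hence `E_{m+2} = 0`, `sahiE_ind_eq_zero_of_absorbingPair`, for every `p ∈ [0,1]^ι`).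

Both are by induction on `k` along the definition of `Z_k` (peel a slot; the deleted and the intersected families are
of the same kind).  No measure theory is needed beyond `sahiE_ind_eq_zero_of_suppZeroFlag`. [this work]
-/

noncomputable section

open scoped Classical

namespace Summit.CriticalPhenomena.PercolationContinuityZ3.Theorems

open Finset Function
open Literature.Combinatorics.Sahi2008
open Literature.Probability.Percolation (DeterminedBy determinedBy_iff)
open Literature.Probability.Percolation.DecisionTree (ind)

variable {ι : Type*}

/-! ### Mutually independent families -/

/-- An intersection of events determined by `S` and `T` is determined by `S ∪ T`. [folklore] -/
theorem determinedBy_inter_union {A B : Set (Set ι)} {S T : Finset ι} (hA : DeterminedBy A (↑S : Set ι))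
    (hB : DeterminedBy B (↑T : Set ι)) : DeterminedBy (A ∩ B) (↑(S ∪ T) : Set ι) := by
  rw [Finset.coe_union]
  exact (hA.mono Set.subset_union_left).inter (hB.mono Set.subset_union_right)

/-- **Mutually independent families are zero flags**: if `k + 2` events are determined by pairwise disjoint finite
coordinate sets, the family lies in `Z_{k+2}`. [this work] -/
theorem suppZeroFlag_of_pairwise_disjoint :
    ∀ (k : ℕ) (U : Fin (k + 2) → Set (Set ι)) (S : Fin (k + 2) → Finset ι),
      (∀ i j, i ≠ j → Disjoint (S i) (S j)) → (∀ j, DeterminedBy (U j) (↑(S j) : Set ι)) →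
      SuppZeroFlag (k + 2) U
  | 0, U, S, hS, hU => ⟨S 0, S 1, hS 0 1 (by decide), hU 0, hU 1⟩
  | k + 1, U, S, hS, hU => by
    refine ⟨0, ?_, fun l => ?_⟩
    · -- the deleted family `U ∘ succ`
      refine suppZeroFlag_of_pairwise_disjoint k _ (fun j => S ((0 : Fin (k + 3)).succAbove j))
        (fun i j hij => hS _ _ fun h => hij (Fin.succAbove_right_injective h)) fun j => hU _
    · -- slot `l` intersected with `U 0`: determining sets `S (succ l) ∪ S 0`, still pairwise disjoint
      refine suppZeroFlag_of_pairwise_disjoint k _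
        (update (fun j => S ((0 : Fin (k + 3)).succAbove j)) l (S ((0 : Fin (k + 3)).succAbove l) ∪ S 0))
        (fun i j hij => ?_) (fun j => ?_)
      · have h0i : (0 : Fin (k + 3)) ≠ (0 : Fin (k + 3)).succAbove i := (Fin.succAbove_ne 0 i).symm
        have h0j : (0 : Fin (k + 3)) ≠ (0 : Fin (k + 3)).succAbove j := (Fin.succAbove_ne 0 j).symm
        have hij' : (0 : Fin (k + 3)).succAbove i ≠ (0 : Fin (k + 3)).succAbove j :=
          fun h => hij (Fin.succAbove_right_injective h)
        by_cases hi : i = l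
        · subst hi
          rw [update_self, update_of_ne (Ne.symm hij)]
          exact disjoint_union_left.2 ⟨hS _ _ hij', hS _ _ h0j⟩
        · by_cases hj : j = l
          · subst hj
            rw [update_self, update_of_ne hi]
            exact disjoint_union_right.2 ⟨hS _ _ hij', hS _ _ (Ne.symm h0i) |>.symm.symm⟩
          · rw [update_of_ne hi, update_of_ne hj]
            exact hS _ _ hij'
      · by_cases hj : j = l
        · subst hj
          simp only [update_self]
          exact determinedBy_inter_union (hU _) (hU 0)
        · simp only [update_of_ne hj]
          exact hU _

/-- Hence `E_{k+2} = 0` for mutually independent families of events, every product measure (re-deriving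
`sahiE_eq_zero_of_indepMoments` on product spaces through `Z_k`). [this work] -/
theorem sahiE_ind_eq_zero_of_pairwise_disjoint [Fintype ι] (p : ι → unitInterval) {k : ℕ}
    (U : Fin (k + 2) → Set (Set ι)) (S : Fin (k + 2) → Finset ι) (hS : ∀ i j, i ≠ j → Disjoint (S i) (S j))
    (hU : ∀ j, DeterminedBy (U j) (↑(S j) : Set ι)) :
    sahiE (bernoulliWeight p) (k + 2) (fun j => ind (U j)) = 0 :=
  sahiE_ind_eq_zero_of_suppZeroFlag p (suppZeroFlag_of_pairwise_disjoint k U S hS hU)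

/-! ### Absorbing pairs (L1) -/

/-- **Absorbing pairs are zero flags** (identity L1 of the cell, all orders): a family `U : Fin (m+2) → events` whose
slots `0, 1` carry events `X, Y` determined by disjoint coordinate sets and whose other slots carry events containing
both `X` and `Y` lies in `Z_{m+2}`.  (Peel the last absorbing slot: intersecting `X` or `Y` with it changes nothing,
intersecting another absorbing event keeps it absorbing.) [this work] -/
theorem suppZeroFlag_absorbingPair :
    ∀ (m : ℕ) (U : Fin (m + 2) → Set (Set ι)),
      SuppZeroFlag 2 ![U 0, U 1] → (∀ j : Fin (m + 2), 2 ≤ j.val → U 0 ⊆ U j ∧ U 1 ⊆ U j) →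
      SuppZeroFlag (m + 2) U
  | 0, U, hXY, _ => by
    have e : U = ![U 0, U 1] := by funext j; fin_cases j <;> rfl
    rw [e]; exact hXY
  | m + 1, U, hXY, hG => by
    -- peel the last slot (an absorbing event since its index is ≥ 2)
    have hlast : 2 ≤ (Fin.last (m + 2)).val := by simp
    obtain ⟨hXG, hYG⟩ := hG (Fin.last (m + 2)) hlast
    have hsub : ∀ (V : Fin (m + 2) → Set (Set ι)), V 0 = U 0 → V 1 = U 1 →
        (∀ j : Fin (m + 2), 2 ≤ j.val → U 0 ⊆ V j ∧ U 1 ⊆ V j) → SuppZeroFlag (m + 2) V := by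
      intro V h0 h1 hV
      refine suppZeroFlag_absorbingPair m V ?_ fun j hj => ?_
      · rw [h0, h1]; exact hXY
      · rw [h0, h1]; exact hV j hj
    have c0 : (Fin.last (m + 2)).succAbove 0 = 0 := by
      rw [Fin.succAbove_last]; rfl
    have c1 : (Fin.last (m + 2)).succAbove 1 = 1 := by
      rw [Fin.succAbove_last]; ext; simp
    have cj : ∀ j : Fin (m + 2), ((Fin.last (m + 2)).succAbove j).val = j.val := fun j => by
      rw [Fin.succAbove_last]; simp
    refine ⟨Fin.last (m + 2), ?_, fun l => ?_⟩
    · refine hsub _ (by rw [c0]) (by rw [c1]) fun j hj => ?_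
      exact hG _ (by rw [cj]; exact hj)
    · refine hsub _ ?_ ?_ fun j hj => ?_
      · by_cases hl : (0 : Fin (m + 2)) = l
        · subst hl
          rw [update_self, c0]
          exact Set.inter_eq_left.2 hXG
        · rw [update_of_ne hl, c0]
      · by_cases hl : (1 : Fin (m + 2)) = l
        · subst hl
          rw [update_self, c1]
          exact Set.inter_eq_left.2 hYG
        · rw [update_of_ne hl, c1]
      · by_cases hjl : j = l
        · subst hjl
          rw [update_self]
          obtain ⟨h0, h1⟩ := hG ((Fin.last (m + 2)).succAbove j) (by rw [cj]; exact hj)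
          exact ⟨Set.subset_inter h0 hXG, Set.subset_inter h1 hYG⟩
        · rw [update_of_ne hjl]
          exact hG _ (by rw [cj]; exact hj)

/-- Hence `E_{m+2}(X, Y, G_1, …, G_m) = 0` for an absorbing pair under every product measure (identity L1 of the cell;
`m = 1` is `Literature.Probability.LatticeModels.sahiE3_eq_zero_of_indep_of_union_subset` on product spaces). [this work] -/
theorem sahiE_ind_eq_zero_of_absorbingPair [Fintype ι] (p : ι → unitInterval) {m : ℕ}
    (U : Fin (m + 2) → Set (Set ι)) (hXY : SuppZeroFlag 2 ![U 0, U 1])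
    (hG : ∀ j : Fin (m + 2), 2 ≤ j.val → U 0 ⊆ U j ∧ U 1 ⊆ U j) :
    sahiE (bernoulliWeight p) (m + 2) (fun j => ind (U j)) = 0 :=
  sahiE_ind_eq_zero_of_suppZeroFlag p (suppZeroFlag_absorbingPair m U hXY hG)

end Summit.CriticalPhenomena.PercolationContinuityZ3.Theorems
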